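import Literature.AlgebraicGeometry.Motives.HodgeStructureLefschetzGroupInternalBlocks
import Literature.AlgebraicGeometry.Motives.HodgeStructureLefschetzGroupRestrictionToRepresentatives
import HarnessLib

/-!
# THE CENTRE OF `S(A)(ℚ)` BLOCK BY BLOCK: `Z(S(H)(ℚ)) ≅ Π_k Z(S(W_k)(ℚ))` ALONG THE CANONICAL BLOCKS (AND ALONG REPRESENTATIVES
# OF THE SIMPLE ISOGENY FACTORS) — MILNE'S PROP. 1.5 `S(A₁) × ⋯ × S(A_s) ⥲ S(A)` RESTRICTED TO CENTRES, THE CRITERION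
# «`γ` IS CENTRAL IFF EVERY BLOCK RESTRICTION IS CENTRAL», AND `#Z(S(H)(ℚ)) = Π_k #Z(S(W_k)(ℚ))`
# (Milne 1999 §1 Prop. 1.5, p. 645 `S₀ = U_{C₀}`, `C₀ = Π K_k`; Moonen–Zarhin 1998 §1 Lemma (1))

[topic AlgebraicGeometry/Motives]

Layer `Literature/AlgebraicGeometry/Motives`, lane `lit-hodgefound` (Track 2 foundations library; prover seat
`lit-hodgefound-p02`, generation 55, self-proposed row g55-#2). THEOREMS ONLY: no definition, no named fact (net debt `0`),
no instance, no notation.  Milne (§1 Prop. 1.5, p. 644): «Let `A₁, …, A_s` be a set of representatives for the simple isogeny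
factors of `A` […]. Any such isogeny induces an isomorphism `S(A₁) × ⋯ × S(A_s) → S(A)`, which is independent of the choice of
the isogeny»; p. 645: the centre part is `S₀(A) = U_{C₀(A)}` with `C₀(A)` «a product of fields» — one field per simple factor,
so `S₀ = Π_k U_{K_k}`: THE CENTRE OF `S(A)` IS COMPUTED FACTOR BY FACTOR.  The tree has Prop. 1.5 on `ℚ`-points as GROUP
isomorphisms with formulas (g52∕g53: `Polarization.exists_mulEquiv_pi_lefschetzGroup_of_hom_orthogonal` ∕ `_of_forall_stable`
∕ `_minimal_stable` along internal blocks, `Polarization.exists_mulEquiv_pi_lefschetzGroup_of_labelling` along representatives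
`T_k` of the isotypy classes).  Here these are RESTRICTED TO THE CENTRES (an isomorphism of groups induces one of centres,
`Subgroup.centerCongr`, and `Z(Π_k G_k) = Π_k Z(G_k)`, `Subgroup.center_pi`):
(i) `Z(S(H)(ℚ)) ≃* Π_k Z(S(W_k, ψ|_{W_k})(ℚ))` with `(f γ)_k v = γ v` on `W_k`, for every Hom-orthogonal (e.g. `E_φ`-stable)
internal direct sum `V = ⊕_k W_k` of sub-Hodge structures, in particular over the CANONICAL blocks (minimal non-zero
`E_φ`-stable sub-Hodge structures), and `Z(S(H)(ℚ)) ≃* Π_k Z(S(T_k, ψ|_{T_k})(ℚ))` along representatives `T_k` of the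
irreducible isotypy classes («`S(A₁) × ⋯ × S(A_s)`»);
(ii) the CRITERION: `γ ∈ S(H)(ℚ)` is central iff it commutes, on each block `W_k`, with every element of `S(W_k)(ℚ)`;
(iii) COUNTING: `#Z(S(H)(ℚ)) = Π_k #Z(S(W_k)(ℚ))` (as `Nat.card`, so `0` as soon as one block has infinite centre), and
`Z(S(H)(ℚ))` is finite iff every `Z(S(W_k)(ℚ))` is finite, infinite iff some block has infinite centre — the block-wise form
of Milne's Summary table (types I–III: finite; type IV: infinite) and of Moonen–Zarhin's Lemma (1).

## The sources, verbatim

* J. S. Milne, *Lefschetz classes on abelian varieties*, Duke Math. J. 96 (1999) 639–675 [Milne1999LefschetzClasses] (held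
  `paper:doi-10-1215-s0012-7094-99-09620-5`, folios 6–7): p. 644 Prop. 1.5 "Let `A₁, …, A_s` be a set of representatives for
  the simple isogeny factors of `A`, so that there exists an isogeny `A₁^{r₁} × ⋯ × A_s^{r_s} → A` for some `r_i > 0`. Any such
  isogeny induces an isomorphism `S(A₁) × ⋯ × S(A_s) → S(A)`, which is independent of the choice of the isogeny. Proof. This
  is an immediate consequence of Proposition 1.1."; p. 645 L1–L14 "`C₀(A)` […] is a product of fields […]. Define `S₀(A)` […]
  `S₀(A)(R) = {γ ∈ C₀(A) ⊗_ℚ R | γ†γ = 1}`. Proposition 1.7. […] an isomorphism of algebraic groups `S₀(A)_{/ℚ_ℓ} → S_ℓ(A)`.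
  Proof. Both `C₀(A)` and `C_ℓ(A)` satisfy the statement of Proposition 1.1, and so we may suppose that `A` is simple."
* B. J. J. Moonen, Yu. G. Zarhin, *Weil classes on abelian varieties*, J. reine angew. Math. 496 (1998) 83–92
  [MoonenZarhin1998WeilClasses] (held `paper:arxiv-alg-geom_9612017`, chunk p0002): «Lemma. (1) The center of `G_div(X)` is the
  group `U_{K_B}` […]; in all other cases it is finite.»
* H. Lange, *Abelian Varieties over the Complex Numbers* (2023) [Lange2023AbelianVarietiesComplex], §2.4.4 Cor. 2.4.26
  (`End_ℚ(X) ≅ ⊕ M_{n_i}(End_ℚ(X_i))` over the simple factors), §7.2.4 Exercise (4) (the Lefschetz group).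

Nearest tree results, BY NAME: the `S(H)(ℚ)`-level isomorphisms quoted above; for complex abelian varieties ∕ `ℂ`-points the
centre files `Literature/AlgebraicGeometry/HodgeTheory/DivisorLefschetzGroupCentre*` and `Milne1999/HodgeGroupIsogeny`
(`Subgroup.centerCongr` along isogenies).  Here: the `ℚ`-Hodge-structure group `ψ.lefschetzGroup`, its centre block by block.

## Dictionary and what is proved (namespace `Literature.AlgebraicGeometry.Motives.HodgeStructure`)

`S(H)(ℚ) = ψ.lefschetzGroup ≤ GL(V)`, `S(W)(ℚ) = (ψ.restrict W).lefschetzGroup` for a sub-Hodge structure `W`, `Z(·) =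
Subgroup.center`; a canonical block is a minimal non-zero `E_φ`-stable `S : SubHodgeStructure H` (the tree's predicate, verbatim).

* §1 `Z(S(H)(ℚ)) ≃* Π_k Z(S(W_k)(ℚ))`: **`Polarization.exists_center_lefschetzGroup_mulEquiv_pi_of_hom_orthogonal`**,
  **`Polarization.exists_center_lefschetzGroup_mulEquiv_pi_of_forall_stable`**,
  **`Polarization.exists_center_lefschetzGroup_mulEquiv_pi_minimal_stable`** (canonical blocks),
  **`Polarization.exists_center_lefschetzGroup_mulEquiv_pi_of_labelling`** (representatives `T_k`: «`S(A₁) × ⋯ × S(A_s)`»).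
* §2 CRITERION: **`Polarization.mem_center_lefschetzGroup_iff_forall_block_comm`** (`γ` central iff it commutes with every
  `δ ∈ S(W_k)(ℚ)` on `W_k`, for all `k`).
* §3 COUNTING: **`Polarization.natCard_center_lefschetzGroup_eq_prod`** (`#Z = Π_k #Z_k`),
  **`Polarization.finite_center_lefschetzGroup_iff_forall_block`**, **`Polarization.infinite_center_lefschetzGroup_iff_exists_block`**,
  **`Polarization.natCard_center_lefschetzGroup_eq_prod_minimal_stable`**, **`Polarization.finite_center_lefschetzGroup_iff_forall_minimal_stable`**.
-/

noncomputable section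

namespace Literature.AlgebraicGeometry.Motives

namespace HodgeStructure

universe u

variable {V : Type u} [AddCommGroup V] [Module ℚ V] [Module.Finite ℚ V] {n : ℤ} {H : HodgeStructure V n}

/-! ## §0 The centre of a product of groups -/

omit [Module.Finite ℚ V] in
/-- Along a group isomorphism `e : G ≃* Π_k K_k` the centre of `G` is the product of the centres: `Z(G) ≃* Π_k Z(K_k)`,
`(f γ)_k = (e γ)_k` (`Subgroup.centerCongr`, `Subgroup.center_pi`). [folklore] -/
private theorem exists_center_mulEquiv_pi_center₅₅ {G : Type*} [Group G] {ι : Type*} {K : ι → Type*} [∀ k, Group (K k)]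
    (e : G ≃* Π k, K k) :
    ∃ f : Subgroup.center G ≃* Π k, Subgroup.center (K k),
      ∀ (γ : Subgroup.center G) (k : ι), ((f γ k : Subgroup.center (K k)) : K k) = e (γ : G) k := by
  have hmem : ∀ (γ : Subgroup.center G) (k : ι), e (γ : G) k ∈ Subgroup.center (K k) := by
    intro γ k
    have h : e (γ : G) ∈ Subgroup.center (Π k, K k) := (Subgroup.centerCongr e γ).2
    rw [Subgroup.center_pi, Subgroup.mem_pi] at h
    exact h k (Set.mem_univ k)
  let f₀ : Subgroup.center G →* Π k, Subgroup.center (K k) :=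
    { toFun := fun γ k => ⟨e (γ : G) k, hmem γ k⟩
      map_one' := funext fun k => Subtype.ext (by
        change e ((1 : Subgroup.center G) : G) k = 1
        rw [OneMemClass.coe_one, map_one, Pi.one_apply])
      map_mul' := fun γ γ' => funext fun k => Subtype.ext (by
        change e ((γ * γ' : Subgroup.center G) : G) k = e (γ : G) k * e (γ' : G) k
        rw [Subgroup.coe_mul, map_mul, Pi.mul_apply]) }
  have hf₀ : ∀ (γ : Subgroup.center G) (k : ι), ((f₀ γ k : Subgroup.center (K k)) : K k) = e (γ : G) k := fun _ _ => rfl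
  refine ⟨MulEquiv.ofBijective f₀ ⟨fun γ γ' h => ?_, fun δ => ?_⟩, hf₀⟩
  · apply Subtype.ext
    apply e.injective
    funext k
    rw [← hf₀ γ k, ← hf₀ γ' k, h]
  · -- the tuple `(δ_k)_k` is central in `Π_k K_k`, so its preimage is central in `G`
    have hδ : (fun k => ((δ k : Subgroup.center (K k)) : K k)) ∈ Subgroup.center (Π k, K k) := by
      rw [Subgroup.center_pi, Subgroup.mem_pi]
      exact fun k _ => (δ k).2
    refine ⟨(Subgroup.centerCongr e).symm ⟨_, hδ⟩, funext fun k => Subtype.ext ?_⟩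
    rw [hf₀]
    change e ((e.symm fun k => ((δ k : Subgroup.center (K k)) : K k)) : G) k = _
    rw [MulEquiv.apply_symm_apply]

/-! ## §1 `Z(S(H)(ℚ)) ≃* Π_k Z(S(W_k)(ℚ))` along internal blocks, canonical blocks, representatives -/

section Blocks

variable {κ : Type*} [Fintype κ] [DecidableEq κ] (W : κ → SubHodgeStructure H)
  (hW : DirectSum.IsInternal fun k => (W k).toSubmodule)

include hW

/-- **THE CENTRE OF `S(H)(ℚ)` BLOCK BY BLOCK — Hom-orthogonal blocks**: along an internal direct sum `V = ⊕_k W_k` of pairwise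
Hom-orthogonal sub-Hodge structures, restriction to the blocks is a group isomorphism
`Z(S(H)(ℚ)) ≃* Π_k Z(S(W_k, ψ|_{W_k})(ℚ))`, `(f γ)_k v = γ v` (the tree's `S(H)(ℚ) ≃* Π_k S(W_k)(ℚ)` restricted to centres:
`Z(Π_k G_k) = Π_k Z(G_k)`). [cite: Milne1999LefschetzClasses, §1 Prop. 1.5 (p. 644) and p. 645 L1–L14 (S₀ = U_{C₀}, C₀ = Π K_k)]
[cite: Lange2023AbelianVarietiesComplex, §7.2.4 Exercise (4)] -/
theorem Polarization.exists_center_lefschetzGroup_mulEquiv_pi_of_hom_orthogonal (ψ : Polarization H)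
    (horth : ∀ k l, k ≠ l → ∀ f : Hom (W k).toHodgeStructure (W l).toHodgeStructure, f = 0) :
    ∃ f : Subgroup.center ψ.lefschetzGroup ≃* Π k, Subgroup.center (ψ.restrict (W k)).lefschetzGroup,
      ∀ (γ : Subgroup.center ψ.lefschetzGroup) (k : κ) (v : (W k).toSubmodule),
        ((((f γ k : Subgroup.center (ψ.restrict (W k)).lefschetzGroup) : (ψ.restrict (W k)).lefschetzGroup) :
          (W k).toSubmodule ≃ₗ[ℚ] (W k).toSubmodule) v : V) = ((γ : ψ.lefschetzGroup) : V ≃ₗ[ℚ] V) v := by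
  obtain ⟨e, he⟩ := ψ.exists_mulEquiv_pi_lefschetzGroup_of_hom_orthogonal W hW horth
  obtain ⟨f, hf⟩ := exists_center_mulEquiv_pi_center₅₅ e
  refine ⟨f, fun γ k v => ?_⟩
  rw [hf, he]

/-- **THE CENTRE OF `S(H)(ℚ)` BLOCK BY BLOCK — `E_φ`-stable blocks**: along an internal direct sum `V = ⊕_k W_k` of `E_φ`-STABLE
sub-Hodge structures (these are Hom-orthogonal), `Z(S(H)(ℚ)) ≃* Π_k Z(S(W_k, ψ|_{W_k})(ℚ))`, `(f γ)_k v = γ v`.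
[cite: Milne1999LefschetzClasses, §1 Prop. 1.5 (p. 644) and p. 645 L1–L14] [cite: Lange2023AbelianVarietiesComplex, §7.2.4 Exercise (4)] -/
theorem Polarization.exists_center_lefschetzGroup_mulEquiv_pi_of_forall_stable (ψ : Polarization H)
    (hst : ∀ k, ∀ a ∈ H.endAlg, ∀ v ∈ (W k).toSubmodule, a v ∈ (W k).toSubmodule) :
    ∃ f : Subgroup.center ψ.lefschetzGroup ≃* Π k, Subgroup.center (ψ.restrict (W k)).lefschetzGroup,
      ∀ (γ : Subgroup.center ψ.lefschetzGroup) (k : κ) (v : (W k).toSubmodule),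
        ((((f γ k : Subgroup.center (ψ.restrict (W k)).lefschetzGroup) : (ψ.restrict (W k)).lefschetzGroup) :
          (W k).toSubmodule ≃ₗ[ℚ] (W k).toSubmodule) v : V) = ((γ : ψ.lefschetzGroup) : V ≃ₗ[ℚ] V) v :=
  ψ.exists_center_lefschetzGroup_mulEquiv_pi_of_hom_orthogonal W hW fun _ _ hkl f =>
    hom_eq_zero_of_forall_stable W hW hst hkl f

/-! ## §2 The criterion: `γ` is central iff every block restriction is central -/

/-- **`γ ∈ S(H)(ℚ)` IS CENTRAL IFF, ON EACH BLOCK `W_k`, IT COMMUTES WITH EVERY ELEMENT OF `S(W_k)(ℚ)`** (Hom-orthogonal internal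
blocks): `γ` preserves each `W_k` (the tree's `Polarization.apply_mem_of_mem_lefschetzGroup`), and along
`S(H)(ℚ) ≃* Π_k S(W_k)(ℚ)` centrality is tested factor by factor — every `δ ∈ S(W_k)(ℚ)` is the restriction of the element of
`S(H)(ℚ)` which is `δ` on `W_k` and the identity on the other blocks. [cite: Milne1999LefschetzClasses, §1 Prop. 1.5 (p. 644) and p. 645 L1–L14]
[cite: Lange2023AbelianVarietiesComplex, §7.2.4 Exercise (4)] -/
theorem Polarization.mem_center_lefschetzGroup_iff_forall_block_comm (ψ : Polarization H)
    (horth : ∀ k l, k ≠ l → ∀ f : Hom (W k).toHodgeStructure (W l).toHodgeStructure, f = 0) (γ : ψ.lefschetzGroup) :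
    γ ∈ Subgroup.center ψ.lefschetzGroup ↔
      ∀ (k : κ) (δ : (W k).toSubmodule ≃ₗ[ℚ] (W k).toSubmodule), δ ∈ (ψ.restrict (W k)).lefschetzGroup →
        ∀ v : (W k).toSubmodule, (γ : V ≃ₗ[ℚ] V) (δ v : V) =
          (δ ⟨(γ : V ≃ₗ[ℚ] V) v, ψ.apply_mem_of_mem_lefschetzGroup W hW γ.2 k v.2⟩ : V) := by
  obtain ⟨e, he⟩ := ψ.exists_mulEquiv_pi_lefschetzGroup_of_hom_orthogonal W hW horth
  -- `(e g)_k w = g w` as elements of `W_k`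
  have he' : ∀ (g : ψ.lefschetzGroup) (k : κ) (w : (W k).toSubmodule),
      (e g k : (W k).toSubmodule ≃ₗ[ℚ] (W k).toSubmodule) w =
        ⟨(g : V ≃ₗ[ℚ] V) w, ψ.apply_mem_of_mem_lefschetzGroup W hW g.2 k w.2⟩ :=
    fun g k w => Subtype.ext (he g k w)
  constructor
  · intro hγ k δ hδ v
    -- `δ` on `W_k`, `1` elsewhere, is `e g` for some `g ∈ S(H)(ℚ)`; `γ g = g γ` on `v ∈ W_k`
    obtain ⟨g, hg⟩ := e.surjective (Pi.mulSingle k ⟨δ, hδ⟩)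
    have hgk : (e g k : (W k).toSubmodule ≃ₗ[ℚ] (W k).toSubmodule) = δ := by
      rw [hg, Pi.mulSingle_eq_same]
    have hcomm := Subgroup.mem_center_iff.1 hγ g
    have h1 : ((γ : V ≃ₗ[ℚ] V) ((g : V ≃ₗ[ℚ] V) v)) = (g : V ≃ₗ[ℚ] V) ((γ : V ≃ₗ[ℚ] V) v) := by
      have h2 := congrArg (fun x : ψ.lefschetzGroup => (x : V ≃ₗ[ℚ] V) (v : V)) hcomm
      simpa only [Subgroup.coe_mul, LinearEquiv.mul_apply] using h2.symm
    have h3 : ((g : V ≃ₗ[ℚ] V) (v : V)) = (δ v : V) := by rw [← he g k v, hgk]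
    have h4 : (g : V ≃ₗ[ℚ] V) ((γ : V ≃ₗ[ℚ] V) v) =
        (δ ⟨(γ : V ≃ₗ[ℚ] V) v, ψ.apply_mem_of_mem_lefschetzGroup W hW γ.2 k v.2⟩ : V) := by
      rw [← he g k ⟨(γ : V ≃ₗ[ℚ] V) v, ψ.apply_mem_of_mem_lefschetzGroup W hW γ.2 k v.2⟩, hgk]
    rw [← h3, h1, h4]
  · intro h
    rw [Subgroup.mem_center_iff]
    intro g
    apply e.injective
    rw [map_mul, map_mul]
    funext k
    rw [Pi.mul_apply, Pi.mul_apply]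
    apply Subtype.ext
    apply LinearEquiv.ext
    intro w
    apply Subtype.ext
    change (((e g k : (W k).toSubmodule ≃ₗ[ℚ] (W k).toSubmodule) ((e γ k : (W k).toSubmodule ≃ₗ[ℚ] (W k).toSubmodule) w)
        : (W k).toSubmodule) : V) =
      (((e γ k : (W k).toSubmodule ≃ₗ[ℚ] (W k).toSubmodule) ((e g k : (W k).toSubmodule ≃ₗ[ℚ] (W k).toSubmodule) w)
        : (W k).toSubmodule) : V)
    rw [he γ k, he' γ k w]
    exact (h k _ (e g k).2 w).symm

/-! ## §3 Counting: `#Z(S(H)(ℚ)) = Π_k #Z(S(W_k)(ℚ))`; finite iff every block is -/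

/-- **`#Z(S(H)(ℚ)) = Π_k #Z(S(W_k)(ℚ))`** along Hom-orthogonal internal blocks (as `Nat.card`: a block with infinite centre makes
both sides `0`) — the block-wise count behind Milne's Summary table (a factor `2` for each block of type I–III with `†` of the
first kind, g54-#8, and `0` = infinite for each block of type IV). [cite: Milne1999LefschetzClasses, §1 Prop. 1.5 (p. 644), p. 645 L1–L14 and §2 Summary p. 652]
[cite: MoonenZarhin1998WeilClasses, §1 Lemma (1)] -/
theorem Polarization.natCard_center_lefschetzGroup_eq_prod (ψ : Polarization H)
    (horth : ∀ k l, k ≠ l → ∀ f : Hom (W k).toHodgeStructure (W l).toHodgeStructure, f = 0) :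
    Nat.card (Subgroup.center ψ.lefschetzGroup) = ∏ k, Nat.card (Subgroup.center (ψ.restrict (W k)).lefschetzGroup) := by
  obtain ⟨f, -⟩ := ψ.exists_center_lefschetzGroup_mulEquiv_pi_of_hom_orthogonal W hW horth
  rw [Nat.card_congr f.toEquiv, Nat.card_pi]

/-- **`Z(S(H)(ℚ))` IS FINITE IFF EVERY BLOCK CENTRE `Z(S(W_k)(ℚ))` IS FINITE** (Hom-orthogonal internal blocks) — «in all other
cases it is finite», block by block. [cite: Milne1999LefschetzClasses, §1 Prop. 1.5 (p. 644) and §2 Summary p. 652]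
[cite: MoonenZarhin1998WeilClasses, §1 Lemma (1)] -/
theorem Polarization.finite_center_lefschetzGroup_iff_forall_block (ψ : Polarization H)
    (horth : ∀ k l, k ≠ l → ∀ f : Hom (W k).toHodgeStructure (W l).toHodgeStructure, f = 0) :
    Finite (Subgroup.center ψ.lefschetzGroup) ↔ ∀ k, Finite (Subgroup.center (ψ.restrict (W k)).lefschetzGroup) := by
  obtain ⟨f, -⟩ := ψ.exists_center_lefschetzGroup_mulEquiv_pi_of_hom_orthogonal W hW horth
  rw [Equiv.finite_iff f.toEquiv]
  constructor
  · intro h k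
    exact Finite.of_surjective (fun x : Π k, Subgroup.center (ψ.restrict (W k)).lefschetzGroup => x k)
      fun y => ⟨Function.update (fun _ => 1) k y, by simp only [Function.update_self]⟩
  · intro h
    exact Pi.finite

/-- **`Z(S(H)(ℚ))` IS INFINITE IFF SOME BLOCK CENTRE `Z(S(W_k)(ℚ))` IS INFINITE** (Hom-orthogonal internal blocks) — a single
block of type IV makes the centre infinite. [cite: Milne1999LefschetzClasses, §1 Prop. 1.5 (p. 644) and §2 Summary p. 652]
[cite: MoonenZarhin1998WeilClasses, §1 Lemma (1)] -/
theorem Polarization.infinite_center_lefschetzGroup_iff_exists_block (ψ : Polarization H)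
    (horth : ∀ k l, k ≠ l → ∀ f : Hom (W k).toHodgeStructure (W l).toHodgeStructure, f = 0) :
    Infinite (Subgroup.center ψ.lefschetzGroup) ↔ ∃ k, Infinite (Subgroup.center (ψ.restrict (W k)).lefschetzGroup) := by
  rw [← not_finite_iff_infinite, ψ.finite_center_lefschetzGroup_iff_forall_block W hW horth, not_forall]
  exact exists_congr fun k => not_finite_iff_infinite

end Blocks

/-! ## §4 The canonical blocks and the representatives -/

section Canonical

open Classical in
/-- **`Z(S(H)(ℚ)) ≃* Π_S Z(S(S, ψ|_S)(ℚ))` OVER THE CANONICAL BLOCKS** — the minimal non-zero `E_φ`-stable sub-Hodge structures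
`S` of `H` (= simple factors of `E_φ` = isotypic components; `V = ⊕_S S`, Hom-orthogonal), `(f γ)_S v = γ v`: the centre of `S(A)`
is the product of the centres of the `S(A_k^{r_k})`, one for each simple factor — `S₀(A) = U_{C₀}`, `C₀ = Π_k K_k`.
[cite: Milne1999LefschetzClasses, §1 Prop. 1.5 (p. 644) and p. 645 L1–L14] [cite: Lange2023AbelianVarietiesComplex, §2.4.4 Cor. 2.4.26 and §7.2.4 Exercise (4)] -/
theorem Polarization.exists_center_lefschetzGroup_mulEquiv_pi_minimal_stable (ψ : Polarization H) :
    ∃ f : Subgroup.center ψ.lefschetzGroup ≃*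
        Π S : {S : SubHodgeStructure H // (∀ a ∈ H.endAlg, ∀ v ∈ S.toSubmodule, a v ∈ S.toSubmodule) ∧ S.toSubmodule ≠ ⊥ ∧
      ∀ S' : SubHodgeStructure H, (∀ a ∈ H.endAlg, ∀ v ∈ S'.toSubmodule, a v ∈ S'.toSubmodule) →
        S'.toSubmodule ≤ S.toSubmodule → S'.toSubmodule = ⊥ ∨ S'.toSubmodule = S.toSubmodule},
          Subgroup.center (ψ.restrict (S : SubHodgeStructure H)).lefschetzGroup,
      ∀ (γ : Subgroup.center ψ.lefschetzGroup) (S : {S : SubHodgeStructure H // (∀ a ∈ H.endAlg, ∀ v ∈ S.toSubmodule,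
        a v ∈ S.toSubmodule) ∧ S.toSubmodule ≠ ⊥ ∧ ∀ S' : SubHodgeStructure H, (∀ a ∈ H.endAlg, ∀ v ∈ S'.toSubmodule,
          a v ∈ S'.toSubmodule) → S'.toSubmodule ≤ S.toSubmodule → S'.toSubmodule = ⊥ ∨ S'.toSubmodule = S.toSubmodule})
          (v : (S : SubHodgeStructure H).toSubmodule),
        ((((f γ S : Subgroup.center (ψ.restrict (S : SubHodgeStructure H)).lefschetzGroup) :
          (ψ.restrict (S : SubHodgeStructure H)).lefschetzGroup) :
            (S : SubHodgeStructure H).toSubmodule ≃ₗ[ℚ] (S : SubHodgeStructure H).toSubmodule) v : V) =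
          ((γ : ψ.lefschetzGroup) : V ≃ₗ[ℚ] V) v := by
  haveI : Fintype {S : SubHodgeStructure H // (∀ a ∈ H.endAlg, ∀ v ∈ S.toSubmodule, a v ∈ S.toSubmodule) ∧ S.toSubmodule ≠ ⊥ ∧
      ∀ S' : SubHodgeStructure H, (∀ a ∈ H.endAlg, ∀ v ∈ S'.toSubmodule, a v ∈ S'.toSubmodule) →
        S'.toSubmodule ≤ S.toSubmodule → S'.toSubmodule = ⊥ ∨ S'.toSubmodule = S.toSubmodule} :=
    ψ.finite_setOf_minimal_stable.fintype
  exact ψ.exists_center_lefschetzGroup_mulEquiv_pi_of_hom_orthogonal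
    (Subtype.val : {S : SubHodgeStructure H // (∀ a ∈ H.endAlg, ∀ v ∈ S.toSubmodule, a v ∈ S.toSubmodule) ∧ S.toSubmodule ≠ ⊥ ∧
      ∀ S' : SubHodgeStructure H, (∀ a ∈ H.endAlg, ∀ v ∈ S'.toSubmodule, a v ∈ S'.toSubmodule) →
        S'.toSubmodule ≤ S.toSubmodule → S'.toSubmodule = ⊥ ∨ S'.toSubmodule = S.toSubmodule} → SubHodgeStructure H)
    ψ.isInternal_minimal_stable
    fun S S' hne f => ψ.hom_eq_zero_of_minimal_stable_of_ne S.2 S'.2 (fun h => hne (Subtype.ext h)) f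

open Classical in
/-- **`#Z(S(H)(ℚ)) = Π_{S canonical} #Z(S(S)(ℚ))`** (as `Nat.card`, over the finitely many canonical blocks).
[cite: Milne1999LefschetzClasses, §1 Prop. 1.5 (p. 644), p. 645 L1–L14 and §2 Summary p. 652] [cite: MoonenZarhin1998WeilClasses, §1 Lemma (1)] -/
theorem Polarization.natCard_center_lefschetzGroup_eq_prod_minimal_stable (ψ : Polarization H) :
    Nat.card (Subgroup.center ψ.lefschetzGroup) =
      ∏ S ∈ ψ.finite_setOf_minimal_stable.toFinset, Nat.card (Subgroup.center (ψ.restrict S).lefschetzGroup) := by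
  obtain ⟨f, -⟩ := ψ.exists_center_lefschetzGroup_mulEquiv_pi_minimal_stable
  haveI : Fintype {S : SubHodgeStructure H // (∀ a ∈ H.endAlg, ∀ v ∈ S.toSubmodule, a v ∈ S.toSubmodule) ∧ S.toSubmodule ≠ ⊥ ∧
      ∀ S' : SubHodgeStructure H, (∀ a ∈ H.endAlg, ∀ v ∈ S'.toSubmodule, a v ∈ S'.toSubmodule) →
        S'.toSubmodule ≤ S.toSubmodule → S'.toSubmodule = ⊥ ∨ S'.toSubmodule = S.toSubmodule} :=
    ψ.finite_setOf_minimal_stable.fintype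
  rw [Nat.card_congr f.toEquiv, Nat.card_pi, ← Finset.prod_subtype ψ.finite_setOf_minimal_stable.toFinset
    (fun S => by rw [Set.Finite.mem_toFinset]; rfl)
    (fun S => Nat.card (Subgroup.center (ψ.restrict S).lefschetzGroup))]

/-- **`Z(S(H)(ℚ))` IS FINITE IFF `Z(S(S, ψ|_S)(ℚ))` IS FINITE FOR EVERY CANONICAL BLOCK `S`** — Milne's Summary ∕ Moonen–Zarhin's
Lemma (1) reduce the size of the centre to the simple factors: finite iff no simple factor contributes an infinite (type IV)
centre. [cite: Milne1999LefschetzClasses, §1 Prop. 1.5 (p. 644) and §2 Summary p. 652] [cite: MoonenZarhin1998WeilClasses, §1 Lemma (1)] -/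
theorem Polarization.finite_center_lefschetzGroup_iff_forall_minimal_stable (ψ : Polarization H) :
    Finite (Subgroup.center ψ.lefschetzGroup) ↔
      ∀ S : SubHodgeStructure H, ((∀ a ∈ H.endAlg, ∀ v ∈ S.toSubmodule, a v ∈ S.toSubmodule) ∧ S.toSubmodule ≠ ⊥ ∧
        ∀ S' : SubHodgeStructure H, (∀ a ∈ H.endAlg, ∀ v ∈ S'.toSubmodule, a v ∈ S'.toSubmodule) →
          S'.toSubmodule ≤ S.toSubmodule → S'.toSubmodule = ⊥ ∨ S'.toSubmodule = S.toSubmodule) →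
        Finite (Subgroup.center (ψ.restrict S).lefschetzGroup) := by
  classical
  haveI : Fintype {S : SubHodgeStructure H // (∀ a ∈ H.endAlg, ∀ v ∈ S.toSubmodule, a v ∈ S.toSubmodule) ∧ S.toSubmodule ≠ ⊥ ∧
      ∀ S' : SubHodgeStructure H, (∀ a ∈ H.endAlg, ∀ v ∈ S'.toSubmodule, a v ∈ S'.toSubmodule) →
        S'.toSubmodule ≤ S.toSubmodule → S'.toSubmodule = ⊥ ∨ S'.toSubmodule = S.toSubmodule} :=
    ψ.finite_setOf_minimal_stable.fintype
  rw [ψ.finite_center_lefschetzGroup_iff_forall_block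
    (Subtype.val : {S : SubHodgeStructure H // (∀ a ∈ H.endAlg, ∀ v ∈ S.toSubmodule, a v ∈ S.toSubmodule) ∧ S.toSubmodule ≠ ⊥ ∧
      ∀ S' : SubHodgeStructure H, (∀ a ∈ H.endAlg, ∀ v ∈ S'.toSubmodule, a v ∈ S'.toSubmodule) →
        S'.toSubmodule ≤ S.toSubmodule → S'.toSubmodule = ⊥ ∨ S'.toSubmodule = S.toSubmodule} → SubHodgeStructure H)
    ψ.isInternal_minimal_stable
    fun S S' hne f => ψ.hom_eq_zero_of_minimal_stable_of_ne S.2 S'.2 (fun h => hne (Subtype.ext h)) f]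
  exact ⟨fun h S hS => h ⟨S, hS⟩, fun h S => h S.1 S.2⟩

end Canonical

section Labelled

variable {ι : Type*} [Fintype ι] [DecidableEq ι] (T : ι → SubHodgeStructure H)
  (hT : DirectSum.IsInternal fun i => (T i).toSubmodule) {κ : Finset ι} {c : ι → κ}
  (hc : ∀ i, ∃ g : Hom (T i).toHodgeStructure (T (c i)).toHodgeStructure, Function.Bijective g.toLinearMap)
  (hκ : ∀ k k' : κ, (∃ g : Hom (T k).toHodgeStructure (T k').toHodgeStructure,
    Function.Bijective g.toLinearMap) → k = k')

include hT hc hκ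

/-- **«`S(A₁) × ⋯ × S(A_s) → S(A)` IS AN ISOMORPHISM» ON CENTRES: `Z(S(H)(ℚ)) ≃* Π_{k ∈ κ} Z(S(T_k, ψ|_{T_k})(ℚ))` along
REPRESENTATIVES `T_k` of the irreducible isotypy classes** of an isotypically labelled irreducible decomposition `V = ⊕ᵢ Tᵢ`
(`(f γ)_k v = γ v` on `T_k`; g53-#2 `Polarization.exists_mulEquiv_pi_lefschetzGroup_of_labelling` restricted to centres) — the
centre of `S(A)` is the product of the centres of the `S(A_k)` of the simple isogeny factors `A_k`, «independent of the choice».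
[cite: Milne1999LefschetzClasses, §1 Prop. 1.5 (p. 644) and p. 645 L1–L14 (Prop. 1.7: «we may suppose that A is simple»)]
[cite: Lange2023AbelianVarietiesComplex, §2.4.4 Cor. 2.4.26 and §7.2.4 Exercise (4)] -/
theorem Polarization.exists_center_lefschetzGroup_mulEquiv_pi_of_labelling (ψ : Polarization H)
    (hirr : ∀ i, (T i).toHodgeStructure.IsIrreducible) :
    ∃ f : Subgroup.center ψ.lefschetzGroup ≃* Π k : κ, Subgroup.center (ψ.restrict (T k)).lefschetzGroup,
      ∀ (γ : Subgroup.center ψ.lefschetzGroup) (k : κ) (v : (T k).toSubmodule),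
        ((((f γ k : Subgroup.center (ψ.restrict (T k)).lefschetzGroup) : (ψ.restrict (T k)).lefschetzGroup) :
          (T k).toSubmodule ≃ₗ[ℚ] (T k).toSubmodule) v : V) = ((γ : ψ.lefschetzGroup) : V ≃ₗ[ℚ] V) v := by
  obtain ⟨e, he⟩ := ψ.exists_mulEquiv_pi_lefschetzGroup_of_labelling T hT hc hκ hirr
  obtain ⟨f, hf⟩ := exists_center_mulEquiv_pi_center₅₅ e
  refine ⟨f, fun γ k v => ?_⟩
  rw [hf, he]

/-- **`#Z(S(H)(ℚ)) = Π_{k ∈ κ} #Z(S(T_k)(ℚ))` over representatives of the simple factors** (as `Nat.card`).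
[cite: Milne1999LefschetzClasses, §1 Prop. 1.5 (p. 644) and §2 Summary p. 652] [cite: MoonenZarhin1998WeilClasses, §1 Lemma (1)] -/
theorem Polarization.natCard_center_lefschetzGroup_eq_prod_of_labelling (ψ : Polarization H)
    (hirr : ∀ i, (T i).toHodgeStructure.IsIrreducible) :
    Nat.card (Subgroup.center ψ.lefschetzGroup) =
      ∏ k : κ, Nat.card (Subgroup.center (ψ.restrict (T k)).lefschetzGroup) := by
  obtain ⟨f, -⟩ := ψ.exists_center_lefschetzGroup_mulEquiv_pi_of_labelling T hT hc hκ hirr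
  rw [Nat.card_congr f.toEquiv, Nat.card_pi]

/-- **`Z(S(H)(ℚ))` IS FINITE IFF `Z(S(T_k)(ℚ))` IS FINITE FOR EVERY REPRESENTATIVE `T_k`** — the size of the centre is decided on
the simple isogeny factors (types I–III finite, type IV infinite). [cite: Milne1999LefschetzClasses, §1 Prop. 1.5 (p. 644) and §2 Summary p. 652]
[cite: MoonenZarhin1998WeilClasses, §1 Lemma (1)] -/
theorem Polarization.finite_center_lefschetzGroup_iff_forall_of_labelling (ψ : Polarization H)
    (hirr : ∀ i, (T i).toHodgeStructure.IsIrreducible) :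
    Finite (Subgroup.center ψ.lefschetzGroup) ↔ ∀ k : κ, Finite (Subgroup.center (ψ.restrict (T k)).lefschetzGroup) := by
  obtain ⟨f, -⟩ := ψ.exists_center_lefschetzGroup_mulEquiv_pi_of_labelling T hT hc hκ hirr
  rw [Equiv.finite_iff f.toEquiv]
  constructor
  · intro h k
    exact Finite.of_surjective (fun x : Π k : κ, Subgroup.center (ψ.restrict (T k)).lefschetzGroup => x k)
      fun y => ⟨Function.update (fun _ => 1) k y, by simp only [Function.update_self]⟩
  · intro h
    exact Pi.finite

end Labelled

end HodgeStructure

end Literature.AlgebraicGeometry.Motives
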